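import Mathlib.Probability.Moments.Variance
import Mathlib.MeasureTheory.Integral.IntervalIntegral.FundThmCalculus
import Mathlib.MeasureTheory.Integral.DominatedConvergence
import Mathlib.Topology.UniformSpace.UniformApproximation
import Mathlib.MeasureTheory.Order.Group.Lattice
import HarnessLib

/-!
# Glue `MeanVarianceL2` of route `OneSphereInfluence`, part 1: abstract mean–variance analysis

Support file (`--supports stmt-AtomisticToContinuum-13622`) for the support item `MeanVarianceL2`
(`Summit.AtomisticToContinuum.HydrodynamicLimit.Theses.OneSphereInfluence.MeanVarianceL2`).
Pure measure theory / one-variable calculus, no hard spheres: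

* `tendsto_integral_abs_of_tendsto_measure` — convergence in probability plus a uniform second
  moment bound implies convergence of first absolute moments (uniform integrability by the
  pointwise truncation `|x| ≤ δ + M 𝟙{δ < |x|} + x²/M`);
* `integral_sub_sq_eq_variance_add` — `E(F − c)² = Var F + (E F − c)²`, and its `lintegral` form;
* `tendsto_sub_of_hasDerivWithinAt_of_tendstoUniformlyOn` — if `g_N` has derivative `d_N` within
  `[0,1]`, `d_N → ∂c` uniformly on `[0,1]` with `d_N` continuous and `c` differentiable within
  `[0,1]`, then `g_N 1 − g_N 0 → c 1 − c 0` (two fundamental theorems of calculus and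
  `TendstoUniformlyOn.tendsto_intervalIntegral_of_continuousOn`);
* `tendsto_lintegral_ofReal_sq_sub` — the abstract mean–variance theorem: score-type derivative
  identity + uniform convergence of the derivatives + anchor at `κ = 0` + vanishing variance at
  `κ = 1` give `∫⁻ ofReal((F_N − c 1)²) d(p 1 N) → 0`.
-/

noncomputable section

open MeasureTheory ProbabilityTheory Filter Set Topology
open scoped ENNReal

namespace Summit.AtomisticToContinuum.HydrodynamicLimit.Theorems.OneSphereInfluenceMeanVarianceL2

/-! ## Uniform integrability from a second-moment bound -/

/-- Pointwise truncation inequality: `|x| ≤ δ + M·𝟙{δ < |x|} + x²/M` for `δ ≥ 0`, `M > 0`.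
[folklore] -/
theorem abs_le_add_ite_add_sq_div {x δ M : ℝ} (hδ : 0 ≤ δ) (hM : 0 < M) :
    |x| ≤ δ + M * (if δ < |x| then 1 else 0) + x ^ 2 / M := by
  have hx2 : x ^ 2 = |x| ^ 2 := (sq_abs x).symm
  by_cases h : δ < |x|
  · rw [if_pos h, mul_one]
    by_cases hxM : |x| ≤ M
    · have : 0 ≤ x ^ 2 / M := div_nonneg (sq_nonneg _) hM.le
      linarith
    · push Not at hxM
      have h1 : |x| ≤ x ^ 2 / M := by
        rw [le_div_iff₀ hM, hx2, sq]
        exact mul_le_mul_of_nonneg_left hxM.le (abs_nonneg _)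
      linarith
  · rw [if_neg h, mul_zero, add_zero]
    push Not at h
    have : 0 ≤ x ^ 2 / M := div_nonneg (sq_nonneg _) hM.le
    linarith

/-- **Convergence in probability with bounded second moments gives convergence of first absolute
moments.** For random variables `X_N` on probability spaces `μ_N` with `∫ X_N² dμ_N ≤ B` and
`μ_N(δ < |X_N|) → 0` for every `δ > 0`: `∫ |X_N| dμ_N → 0`. [folklore] -/
theorem tendsto_integral_abs_of_tendsto_measure {Ω : ℕ → Type*} [∀ N, MeasurableSpace (Ω N)]
    {μ : (N : ℕ) → Measure (Ω N)} [∀ N, IsProbabilityMeasure (μ N)] {X : (N : ℕ) → Ω N → ℝ}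
    (hXm : ∀ N, Measurable (X N)) (hX2 : ∀ N, Integrable (fun ω => X N ω ^ 2) (μ N)) {B : ℝ}
    (hB : ∀ N, ∫ ω, X N ω ^ 2 ∂μ N ≤ B)
    (hprob : ∀ δ : ℝ, 0 < δ → Tendsto (fun N => μ N {ω | δ < |X N ω|}) atTop (𝓝 0)) :
    Tendsto (fun N => ∫ ω, |X N ω| ∂μ N) atTop (𝓝 0) := by
  rw [Metric.tendsto_atTop]
  intro ε hε
  have hB0 : 0 ≤ B := (integral_nonneg fun _ => sq_nonneg _).trans (hB 0)
  set δ : ℝ := ε / 4 with hδ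
  have hδ0 : 0 < δ := by positivity
  set M : ℝ := 4 * B / ε + 1 with hM
  have hM0 : 0 < M := by positivity
  have hBM : B / M ≤ ε / 4 := by
    rw [div_le_iff₀ hM0, hM]
    have : ε / 4 * (4 * B / ε + 1) = B + ε / 4 := by field_simp
    rw [this]
    linarith
  have hev := (ENNReal.tendsto_toReal ENNReal.zero_ne_top).comp (hprob δ hδ0)
  rw [ENNReal.toReal_zero] at hev
  obtain ⟨N₀, hN₀⟩ := Metric.tendsto_atTop.1 hev (ε / (4 * M)) (by positivity)
  refine ⟨N₀, fun N hN => ?_⟩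
  have hAm : MeasurableSet {ω | δ < |X N ω|} := measurableSet_lt measurable_const (hXm N).abs
  have hμ : (μ N).real {ω | δ < |X N ω|} < ε / (4 * M) := by
    have h := hN₀ N hN
    rw [Real.dist_eq, sub_zero] at h
    simpa [measureReal_def, Function.comp] using (le_abs_self _).trans_lt h
  have hint1 : Integrable (fun ω => |X N ω|) (μ N) :=
    (((memLp_two_iff_integrable_sq (hXm N).aestronglyMeasurable).2 (hX2 N)).integrable
      one_le_two).abs
  have hind : Integrable (fun ω => M * (if δ < |X N ω| then (1 : ℝ) else 0)) (μ N) := by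
    refine Integrable.const_mul ?_ M
    have : (fun ω => if δ < |X N ω| then (1 : ℝ) else 0) = {ω | δ < |X N ω|}.indicator 1 := by
      funext ω
      simp only [Set.indicator_apply, Set.mem_setOf_eq, Pi.one_apply]
    rw [this]
    exact (integrable_const (1 : ℝ)).indicator hAm
  have hpt : ∀ ω, |X N ω| ≤ δ + M * (if δ < |X N ω| then (1 : ℝ) else 0) + X N ω ^ 2 / M :=
    fun ω => abs_le_add_ite_add_sq_div hδ0.le hM0
  have h12 : Integrable (fun ω => δ + M * (if δ < |X N ω| then (1 : ℝ) else 0)) (μ N) :=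
    (integrable_const δ).add hind
  have h3i : Integrable (fun ω => X N ω ^ 2 / M) (μ N) := (hX2 N).div_const M
  have h123 : Integrable (fun ω => δ + M * (if δ < |X N ω| then (1 : ℝ) else 0) + X N ω ^ 2 / M)
      (μ N) := h12.add h3i
  have hI : ∫ ω, |X N ω| ∂μ N ≤ δ + M * (μ N).real {ω | δ < |X N ω|} + (∫ ω, X N ω ^ 2 ∂μ N) / M := by
    calc ∫ ω, |X N ω| ∂μ N
        ≤ ∫ ω, (δ + M * (if δ < |X N ω| then (1 : ℝ) else 0) + X N ω ^ 2 / M) ∂μ N :=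
          integral_mono hint1 h123 hpt
      _ = δ + M * (μ N).real {ω | δ < |X N ω|} + (∫ ω, X N ω ^ 2 ∂μ N) / M := by
          rw [integral_add h12 h3i, integral_add (integrable_const δ) hind, integral_const,
            integral_const_mul, integral_div]
          simp only [smul_eq_mul, probReal_univ, one_mul]
          congr 2
          have : (fun ω => if δ < |X N ω| then (1 : ℝ) else 0) = {ω | δ < |X N ω|}.indicator 1 := by
            funext ω
            simp only [Set.indicator_apply, Set.mem_setOf_eq, Pi.one_apply]
          rw [this, integral_indicator_one hAm]
  rw [Real.dist_eq, sub_zero, abs_of_nonneg (integral_nonneg fun _ => abs_nonneg _)]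
  have h2 : M * (μ N).real {ω | δ < |X N ω|} ≤ M * (ε / (4 * M)) :=
    mul_le_mul_of_nonneg_left hμ.le hM0.le
  have h3 : (∫ ω, X N ω ^ 2 ∂μ N) / M ≤ ε / 4 := (div_le_div_of_nonneg_right (hB N) hM0.le).trans hBM
  have h4 : M * (ε / (4 * M)) = ε / 4 := by field_simp
  calc ∫ ω, |X N ω| ∂μ N ≤ δ + M * (μ N).real {ω | δ < |X N ω|} + (∫ ω, X N ω ^ 2 ∂μ N) / M := hI
    _ ≤ ε / 4 + ε / 4 + ε / 4 := by rw [hδ] at *; linarith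
    _ < ε := by linarith

/-- Convergence in probability with bounded second moments gives convergence of the means to `0`.
[folklore] -/
theorem tendsto_integral_of_tendsto_measure {Ω : ℕ → Type*} [∀ N, MeasurableSpace (Ω N)]
    {μ : (N : ℕ) → Measure (Ω N)} [∀ N, IsProbabilityMeasure (μ N)] {X : (N : ℕ) → Ω N → ℝ}
    (hXm : ∀ N, Measurable (X N)) (hX2 : ∀ N, Integrable (fun ω => X N ω ^ 2) (μ N)) {B : ℝ}
    (hB : ∀ N, ∫ ω, X N ω ^ 2 ∂μ N ≤ B)
    (hprob : ∀ δ : ℝ, 0 < δ → Tendsto (fun N => μ N {ω | δ < |X N ω|}) atTop (𝓝 0)) :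
    Tendsto (fun N => ∫ ω, X N ω ∂μ N) atTop (𝓝 0) := by
  refine squeeze_zero_norm (fun N => ?_) (tendsto_integral_abs_of_tendsto_measure hXm hX2 hB hprob)
  rw [Real.norm_eq_abs]
  exact abs_integral_le_integral_abs

/-! ## Mean–variance decomposition of the mean-square deviation -/

/-- `E(F − c)² = Var F + (E F − c)²` on a probability space, for `F ∈ L²`. [folklore] -/
theorem integral_sub_sq_eq_variance_add {Ω : Type*} [MeasurableSpace Ω] {μ : Measure Ω}
    [IsProbabilityMeasure μ] {F : Ω → ℝ} (hF : MemLp F 2 μ) (c : ℝ) :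
    ∫ ω, (F ω - c) ^ 2 ∂μ = variance F μ + (∫ ω, F ω ∂μ - c) ^ 2 := by
  have h1 : MemLp (fun ω => F ω - c) 2 μ := hF.sub (memLp_const c)
  have h2 := variance_eq_sub h1
  rw [variance_sub_const hF.aestronglyMeasurable] at h2
  have h3 : ∫ ω, (F ω - c) ∂μ = (∫ ω, F ω ∂μ) - c := by
    rw [integral_sub (hF.integrable one_le_two) (integrable_const c), integral_const]
    simp
  have h4 : μ[(fun ω => F ω - c) ^ 2] = ∫ ω, (F ω - c) ^ 2 ∂μ := rfl
  rw [h4] at h2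
  have h5 : μ[fun ω => F ω - c] = ∫ ω, (F ω - c) ∂μ := rfl
  rw [h5, h3] at h2
  linarith

/-- `∫⁻ ofReal((F − c)²) = ofReal(Var F + (E F − c)²)` on a probability space, for `F ∈ L²`.
[folklore] -/
theorem lintegral_ofReal_sub_sq_eq {Ω : Type*} [MeasurableSpace Ω] {μ : Measure Ω}
    [IsProbabilityMeasure μ] {F : Ω → ℝ} (hF : MemLp F 2 μ) (c : ℝ) :
    ∫⁻ ω, ENNReal.ofReal ((F ω - c) ^ 2) ∂μ =
      ENNReal.ofReal (variance F μ + (∫ ω, F ω ∂μ - c) ^ 2) := by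
  have h1 : MemLp (fun ω => F ω - c) 2 μ := hF.sub (memLp_const c)
  rw [← integral_sub_sq_eq_variance_add hF c,
    ofReal_integral_eq_lintegral_ofReal h1.integrable_sq (ae_of_all _ fun _ => sq_nonneg _)]

/-! ## Two fundamental theorems of calculus and a uniform limit -/

/-- If `g` has derivative `d κ` within `[0,1]` at every `κ ∈ [0,1]` and `d` is continuous on
`[0,1]`, then `∫₀¹ d = g 1 − g 0`. [folklore] -/
theorem intervalIntegral_eq_sub_of_hasDerivWithinAt_Icc {g d : ℝ → ℝ}
    (hg : ∀ κ ∈ Icc (0 : ℝ) 1, HasDerivWithinAt g (d κ) (Icc 0 1) κ)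
    (hd : ContinuousOn d (Icc 0 1)) : ∫ κ in (0 : ℝ)..1, d κ = g 1 - g 0 := by
  refine intervalIntegral.integral_eq_sub_of_hasDerivAt_of_le zero_le_one
    (fun κ hκ => (hg κ hκ).continuousWithinAt) (fun κ hκ => ?_) ?_
  · exact (hg κ (Ioo_subset_Icc_self hκ)).hasDerivAt (Icc_mem_nhds hκ.1 hκ.2)
  · exact (hd.mono (by rw [uIcc_of_le zero_le_one])).intervalIntegrable

/-- **Uniform limit of derivative identities.** If eventually `g_N` has derivative `d_N κ` within
`[0,1]` on `[0,1]` with `d_N` continuous, `d_N → ∂c` uniformly on `[0,1]` (one-sided derivative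
`derivWithin c (Icc 0 1)`), and `c` is differentiable within `[0,1]` on `[0,1]`, then
`g_N 1 − g_N 0 → c 1 − c 0`. [folklore] -/
theorem tendsto_sub_of_hasDerivWithinAt_of_tendstoUniformlyOn {g d : ℕ → ℝ → ℝ} {c : ℝ → ℝ}
    (hg : ∀ᶠ N in atTop, ∀ κ ∈ Icc (0 : ℝ) 1, HasDerivWithinAt (g N) (d N κ) (Icc 0 1) κ)
    (hd : ∀ᶠ N in atTop, ContinuousOn (d N) (Icc 0 1))
    (hu : TendstoUniformlyOn d (fun κ => derivWithin c (Icc 0 1) κ) atTop (Icc 0 1))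
    (hc : ∀ κ ∈ Icc (0 : ℝ) 1, DifferentiableWithinAt ℝ c (Icc 0 1) κ) :
    Tendsto (fun N => g N 1 - g N 0) atTop (𝓝 (c 1 - c 0)) := by
  -- the limit derivative is continuous as a uniform limit of continuous functions
  have hDc : ContinuousOn (fun κ => derivWithin c (Icc 0 1) κ) (Icc 0 1) := hu.continuousOn hd.frequently
  -- FTC for the limit
  have hcFTC : ∫ κ in (0 : ℝ)..1, derivWithin c (Icc 0 1) κ = c 1 - c 0 :=
    intervalIntegral_eq_sub_of_hasDerivWithinAt_Icc (fun κ hκ => (hc κ hκ).hasDerivWithinAt) hDc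
  -- FTC for the approximants, eventually
  have hgFTC : ∀ᶠ N in atTop, ∫ κ in (0 : ℝ)..1, d N κ = g N 1 - g N 0 := by
    filter_upwards [hg, hd] with N hgN hdN
    exact intervalIntegral_eq_sub_of_hasDerivWithinAt_Icc hgN hdN
  -- uniform convergence of continuous functions gives convergence of the integrals
  have hI : Tendsto (fun N => ∫ κ in (0 : ℝ)..1, d N κ) atTop
      (𝓝 (∫ κ in (0 : ℝ)..1, derivWithin c (Icc 0 1) κ)) := by
    refine TendstoUniformlyOn.tendsto_intervalIntegral_of_continuousOn ?_ ?_
    · simpa only [uIcc_of_le (zero_le_one : (0 : ℝ) ≤ 1)] using hd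
    · simpa only [uIcc_of_le (zero_le_one : (0 : ℝ) ≤ 1)] using hu
  rw [hcFTC] at hI
  exact hI.congr' hgFTC

/-! ## The abstract mean–variance theorem -/

/-- **Abstract mean–variance theorem.** Let `p κ N` be measures (`p 1 N` probability measures),
`F_N ∈ L²(p 1 N)` observables, and `c : ℝ → ℝ`. If eventually `κ ↦ E_{p κ N} F_N` has a
derivative `d_N κ` within `[0,1]` on `[0,1]` (a score identity) with `d_N` continuous, `d_N → ∂c`
uniformly on `[0,1]`, `c` is differentiable within `[0,1]`, the anchor `E_{p 0 N} F_N → c 0`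
holds and `Var_{p 1 N} F_N → 0`, then `∫⁻ ofReal((F_N − c 1)²) d(p 1 N) → 0`. [folklore] -/
theorem tendsto_lintegral_ofReal_sq_sub {Ω : ℕ → Type*} [∀ N, MeasurableSpace (Ω N)]
    {p : ℝ → (N : ℕ) → Measure (Ω N)} {F : (N : ℕ) → Ω N → ℝ} {d : ℕ → ℝ → ℝ} {c : ℝ → ℝ}
    (hprob : ∀ N, IsProbabilityMeasure (p 1 N))
    (hderiv : ∀ᶠ N in atTop, ∀ κ ∈ Icc (0 : ℝ) 1,
      HasDerivWithinAt (fun κ => ∫ ω, F N ω ∂(p κ N)) (d N κ) (Icc 0 1) κ)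
    (hcont : ∀ᶠ N in atTop, ContinuousOn (d N) (Icc 0 1))
    (hunif : TendstoUniformlyOn d (fun κ => derivWithin c (Icc 0 1) κ) atTop (Icc 0 1))
    (hc : ∀ κ ∈ Icc (0 : ℝ) 1, DifferentiableWithinAt ℝ c (Icc 0 1) κ)
    (hanchor : Tendsto (fun N => ∫ ω, F N ω ∂(p 0 N)) atTop (𝓝 (c 0)))
    (hvar : Tendsto (fun N => variance (F N) (p 1 N)) atTop (𝓝 0))
    (hmem : ∀ N, MemLp (F N) 2 (p 1 N)) :
    Tendsto (fun N => ∫⁻ ω, ENNReal.ofReal ((F N ω - c 1) ^ 2) ∂(p 1 N)) atTop (𝓝 0) := by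
  have hsub := tendsto_sub_of_hasDerivWithinAt_of_tendstoUniformlyOn hderiv hcont hunif hc
  have hmean : Tendsto (fun N => ∫ ω, F N ω ∂(p 1 N)) atTop (𝓝 (c 1)) := by
    have h := hsub.add hanchor
    simp only [sub_add_cancel] at h
    exact h
  have hbias : Tendsto (fun N => (∫ ω, F N ω ∂(p 1 N) - c 1) ^ 2) atTop (𝓝 0) := by
    have h := (hmean.sub_const (c 1)).pow 2
    simpa using h
  have hsum : Tendsto (fun N => variance (F N) (p 1 N) + (∫ ω, F N ω ∂(p 1 N) - c 1) ^ 2) atTop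
      (𝓝 0) := by simpa using hvar.add hbias
  have h := ENNReal.tendsto_ofReal hsum
  rw [ENNReal.ofReal_zero] at h
  refine h.congr fun N => ?_
  haveI := hprob N
  exact (lintegral_ofReal_sub_sq_eq (hmem N) (c 1)).symm

end Summit.AtomisticToContinuum.HydrodynamicLimit.Theorems.OneSphereInfluenceMeanVarianceL2

end
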